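import Summits.HubbardSuperconductivity.HubbardLadder.NeelSignC14B14
import Summits.HubbardSuperconductivity.HubbardLadder.NeelSignC24B24
import HarnessLib

/-!
# The typed conjecture (S) through distance 6, BY NAME: `NeelSignUniformUpTo 6 ↔ cells (0,6), (1,5), (3,3)` (HubbardLadder R2, lineage B)

HONEST FRAMING: ladder R1–R4 with certified numbers; no claim on H/H₀.  Reference model only (spin-½ Heisenberg antiferromagnet on
even tori); BOOKKEEPING over landed kernel rows in the style of `NeelSignUniformShells` (r2) — it proves no new inequality and asserts
nothing about Néel order or the Hubbard model.  Inputs: `neelSignUniformUpTo_five` (`NeelSignC14B14`), `neelSignCell_2_4` (`NeelSignC24B24`),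
`neelSignCell_comm` (`NeelSignUniformShells`).  Pen: r2-eng-2 g11 (staged with the (2,4) road `typing24/`; files only after both cell modules are BUILT).
[cite: KLS1988JSP, p. 1021] [cite: DLS1978, Theorem 4.2]
-/

noncomputable section

namespace Summit.HubbardSuperconductivity.HubbardLadder

open Literature.MathematicalPhysics.QuantumLattice Summit.HubbardSuperconductivity.Conjectures

/-! ### Shell 6 of the typed conjecture (S), BY NAME -/

/-- **Shell 6 is the three cells `(0,6)`, `(1,5)`, `(3,3)`**: `NeelSignUniformUpTo 6 ↔ NeelSignCell 0 6 ∧ NeelSignCell 1 5 ∧ NeelSignCell 3 3`.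
Distance `≤ 5` is the tree's `neelSignUniformUpTo_five` (`NeelSignC14B14`: cells `(0,4)` A20 and `(1,4)` B14 on top of `NeelSignUniformShells`);
at distance 6 the cell `(2,4)` is `neelSignCell_2_4` (`NeelSignC24B24`, certificate B24) and `(4,2)`, `(5,1)`, `(6,0)` are transposes
(`neelSignCell_comm`).  What is open through distance 6 is named by the kernel: `(0,6)`, `(1,5)` (never probed by an `L`-uniform arm of
record) and `(3,3)` (LP value `0` on lineage B's arm rp 8×15 + pos 16×16 + LT + Σ at R = 15, E-PR-21: EXHAUSTED).  BOOKKEEPING ONLY over landed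
kernel rows — no new inequality.  HONEST FRAMING: ladder R1–R4 with certified numbers; no claim on H/H₀. [cite: KLS1988JSP, p. 1021] -/
theorem neelSignUniformUpTo_six_iff :
    NeelSignUniformUpTo 6 ↔ NeelSignCell 0 6 ∧ NeelSignCell 1 5 ∧ NeelSignCell 3 3 := by
  constructor
  · intro h
    exact ⟨h 0 6 (by norm_num), h 1 5 (by norm_num), h 3 3 (by norm_num)⟩
  · rintro ⟨h06, h15, h33⟩ a b hab
    rcases Nat.lt_or_ge (a + b) 6 with hlt | hge
    · exact neelSignUniformUpTo_five a b (by omega)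
    · have ha : a ≤ 6 := by omega
      interval_cases a
      · obtain rfl : b = 6 := by omega
        exact h06
      · obtain rfl : b = 5 := by omega
        exact h15
      · obtain rfl : b = 4 := by omega
        exact neelSignCell_2_4
      · obtain rfl : b = 3 := by omega
        exact h33
      · obtain rfl : b = 2 := by omega
        exact neelSignCell_comm.mp neelSignCell_2_4
      · obtain rfl : b = 1 := by omega
        exact neelSignCell_comm.mp h15
      · obtain rfl : b = 0 := by omega
        exact neelSignCell_comm.mp h06

/-- The distance-6 truncation of (S) from its three open cells (converse direction of `neelSignUniformUpTo_six_iff`, for assembly).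
HONEST FRAMING: ladder R1–R4 with certified numbers; no claim on H/H₀. [cite: KLS1988JSP, p. 1021] -/
theorem neelSignUniformUpTo_six_of_cells (h06 : NeelSignCell 0 6) (h15 : NeelSignCell 1 5) (h33 : NeelSignCell 3 3) :
    NeelSignUniformUpTo 6 :=
  neelSignUniformUpTo_six_iff.mpr ⟨h06, h15, h33⟩

/-- (S) itself implies the three open shell-6 cells (instance, for the record). HONEST FRAMING: ladder R1–R4 with certified numbers; no claim on H/H₀.
[cite: KLS1988JSP, p. 1021] -/
theorem neelSignCells_shellSix_of_uniform (h : NeelSignUniform) : NeelSignCell 0 6 ∧ NeelSignCell 1 5 ∧ NeelSignCell 3 3 :=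
  ⟨h 0 6, h 1 5, h 3 3⟩

end Summit.HubbardSuperconductivity.HubbardLadder

end
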